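import Literature.AlgebraicGeometry.AbelianSchemes.SerreTensorRecognitionOfPoints
import Literature.AlgebraicGeometry.AbelianSchemes.SerreTranslateComposition
import HarnessLib

/-!
# The Frobenius twist READ OFF AN ISOGENY ROOF: `A —q̄→ B̄ ←c̄— A″` with `Ker c̄ = A″[𝔭]`, `Ker F_q = q̄⁻¹(B̄[𝔠])` and `𝔭𝔠 = 𝔞`
# give `A^{(q)} ≅ A″ ⊗_𝒪 𝔞⁻¹` canonically (σ2-GLUE: roof ⟶ σ2-CORE)

Topic `Literature/AlgebraicGeometry/AbelianSchemes`, namespace `Literature.AlgebraicGeometry.AbelianSchemes.AbelianSchemeOver`.  THEOREMS ONLY (no definition,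
no named fact, no `instance`, no notation, no `sorry`).  Cell `hodgecm-mathlib` (D-0151), FLOOR 0, P6 «MOD programme» (crux hLiu418 = stmt-HodgeConjecture-24832,
`--supports`, count-neutral), σ2 (β′) lineage of `stub_HFROB`, organ **σ2-GLUE-A «THE FROBENIUS TWIST READ OFF THE DOWNSTAIRS ROOF»**: the moduli datum's (R-2)
`Roof₀` (Defs v0.5b) presents the canonical Hecke translate downstairs as a roof `A_x̄ —q̄→ B̄ ←c̄— A_x̄″` of homomorphisms with (r1₀) `q̄` flat surjective, (r2₀)
`Ker c̄ = A_x̄″[𝔭]` AS SUBGROUP FUNCTORS and `c̄` surjective, (r4₀) a COMMON intertwiner `ι(a) ≫ q̄ = q̄ ≫ b`, `ι″(a) ≫ c̄ = c̄ ≫ b`, and (rL) the Frobenius-kernel law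
`Ker F_q = q̄⁻¹(B̄[𝔠])`; with `𝔭𝔠 = 𝔞` this file produces the `𝒪`-equivariant isomorphism of abelian `k`-schemes **`e′ : A^{(q)} ≅ A″ ⊗_𝒪 𝔞⁻¹`** together with
`e₁ : A″ ⊗_𝒪 𝔭⁻¹ ≅ B̄` (`ψ_𝔭 ≫ e₁ = c̄`) and the cover `χ : A″ ⊗ 𝔭⁻¹ → A″ ⊗ 𝔞⁻¹` (`ψ_𝔭 ≫ χ = ψ_𝔞`) satisfying **`F_q ≫ e′ = q̄ ≫ e₁⁻¹ ≫ χ`** — the AV-part of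
«`𝒯₀(red₀(quotΩ y L)) ⊗ 𝔞_γ⁻¹ ≅ 𝒯₀(red₀ y)^{(q)}`» in the HFROB ← `frob₀` derivation (card J10), by composing ★ (G1b §3)
`SerreTensorRecognitionOfPoints.exists_iso_serreTranslate_comp_eq_of_comp_eq_one_iff_forall_mem` (rank-free recognition `B̄ ≅ A″ ⊗ 𝔭⁻¹`) with ★ (σ2-CORE, π₀-free)
`SerreTranslateComposition.exists_iso_relFrobeniusHom_comp_eq_comp_serreTranslate_of_mul_eq` at `ρ′ := q̄ ≫ e₁⁻¹`.  HC_CM is proved only modulo the 2 remaining named inputs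
(hLiu418, h413) until rung 0 closes; this file discharges none of them.

## Contents (`k = k̄`, `p` the exponential characteristic, `q = pⁿ`; `A A″ : AbelianVariety k` with `𝒪`-actions `act`, `act″` on the abelian `k`-schemes
`(ofAbelianVariety A).toOver`, `(ofAbelianVariety A″).toOver` — the currency of ★ σ2-CORE; `B̄ : AbelianSchemeOver (Spec k)`; presentations `(Eᵢ, Pᵢ, Qᵢ, Nᵢ)` of `𝔭⁻¹`, `𝔠⁻¹`, `𝔞⁻¹` as in ★ `SerreTranslateComposition`)
* §1 `comp_iso_inv_eq_one_iff` (`x ≫ e⁻¹ = 1 ↔ x = 1` for a homomorphic iso), `comp_inv_eq_inv_comp_of_comp_hom_eq` (intertwiners pass to the inverse),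
  `hecke_equivariant_of_roof` (`ι(a) ≫ (q̄ ≫ e₁⁻¹) = (q̄ ≫ e₁⁻¹) ≫ ι_{A″⊗𝔭⁻¹}(a)` from the COMMON intertwiner of (r4₀)), `frobenius_kernel_law_of_roof` ((rL) in `ρ′`-form).
* §2 **`exists_iso_frobeniusTwist_serreTensor_of_roof`** — the head (no `[IsMonHom F_q]` binder: ★ `isMonHom_relFrobeniusHom`).

## References
* [MumfordAV1970] D. Mumford, *Abelian Varieties* (1970), §7 Thm. 4 (p. 72); §15 Thm. 1 (p. 143).
* [Shimura1998] G. Shimura, *Abelian Varieties with Complex Multiplication and Modular Functions* (1998), §13.1 Thm. 1 (pp. 97–99).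
* [MilneCM2006] J. S. Milne, *Complex Multiplication* (2006), §7 (Def. 7.19, Prop. 7.22, Rem. 7.23).
* [Liu2021] Y. Liu, Prop. D.8 (3) (p. 135, proof pp. 136–138).
-/

noncomputable section

universe u

open CategoryTheory CategoryTheory.Limits AlgebraicGeometry MonoidalCategory CartesianMonoidalCategory
open scoped MonObj

namespace Literature.AlgebraicGeometry.AbelianSchemes

namespace AbelianSchemeOver

open Literature.AlgebraicGeometry.Motives Literature.AlgebraicGeometry.Motives.AbelianVariety

/-! ## §1 Bookkeeping for the roof -/

section Bookkeeping

variable {S : Scheme.{u}} {Y Z : Over S}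

/-- `x ≫ e⁻¹ = 1 ↔ x = 1` for an isomorphism `e` of group objects whose `hom` is a homomorphism. [cite: MumfordAV1970, §7 Thm. 4 (p. 72)] -/
theorem comp_iso_inv_eq_one_iff [GrpObj Y] [GrpObj Z] (e : Y ≅ Z) [IsMonHom e.hom] {T : Over S} (x : T ⟶ Z) : x ≫ e.inv = 1 ↔ x = 1 := by
  rw [Iso.comp_inv_eq, MonObj.one_comp]

/-- Intertwiners pass to the inverse: `u ≫ e = e ≫ b` gives `b ≫ e⁻¹ = e⁻¹ ≫ u`. [cite: MumfordAV1970, §7 Thm. 4 (p. 72)] -/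
theorem comp_inv_eq_inv_comp_of_comp_hom_eq (e : Y ≅ Z) {u : Y ⟶ Y} {b : Z ⟶ Z} (h : u ≫ e.hom = e.hom ≫ b) :
    b ≫ e.inv = e.inv ≫ u := by
  rw [Iso.comp_inv_eq, Category.assoc, Iso.eq_inv_comp, h]

end Bookkeeping

/-! ## §2 The Frobenius twist read off the roof -/

section Roof

variable {k : Type u} [Field k] (p : ℕ) [ExpChar k p] (n : ℕ) {A A'' : AbelianVariety k}
  {B : AbelianSchemeOver (Spec (.of k))} {O : Type*} [CommRing O]
  (act : (AbelianScheme.ofAbelianVariety A).toOver.RingAction O) (act'' : (AbelianScheme.ofAbelianVariety A'').toOver.RingAction O)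
  [IsCommMonObj (AbelianScheme.ofAbelianVariety A'').toOver.X]
  {m₁ : ℕ} (E₁ : Matrix (Fin m₁) (Fin m₁) O) (hE₁ : E₁ * E₁ = E₁) (P₁ : Matrix (Fin m₁) (Fin 1) O) (Q₁ : Matrix (Fin 1) (Fin m₁) O) {N₁ : ℕ}
  {m₂ : ℕ} (E₂ : Matrix (Fin m₂) (Fin m₂) O) (hE₂ : E₂ * E₂ = E₂) (P₂ : Matrix (Fin m₂) (Fin 1) O) (Q₂ : Matrix (Fin 1) (Fin m₂) O) {N₂ : ℕ}
  {m₃ : ℕ} (E₃ : Matrix (Fin m₃) (Fin m₃) O) (hE₃ : E₃ * E₃ = E₃) (P₃ : Matrix (Fin m₃) (Fin 1) O) (Q₃ : Matrix (Fin 1) (Fin m₃) O) {N₃ : ℕ}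
  (q : (AbelianScheme.ofAbelianVariety A).toOver.X ⟶ B.X) (c : (AbelianScheme.ofAbelianVariety A'').toOver.X ⟶ B.X)

/-- **(r4₀) ⇒ HECKE EQUIVARIANCE**: if `e₁ : A″ ⊗ 𝔭⁻¹ ≅ B̄` satisfies `ψ_𝔭 ≫ e₁ = c̄` and `a ∈ 𝒪` has a COMMON intertwiner `b` (`ι(a) ≫ q̄ = q̄ ≫ b`, `ι″(a) ≫ c̄ = c̄ ≫ b`), then
`ρ′ := q̄ ≫ e₁⁻¹` intertwines `ι(a)` with the Serre action `ι_{A″⊗𝔭⁻¹}(a)` (cancel the fppf epimorphism `ψ_𝔭`, ★ `serreAction_comp_eq_comp_of_comp_eq`).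
[cite: MumfordAV1970, §7 Thm. 4 (p. 72)] [cite: MilneCM2006, §7 (Def. 7.19, Prop. 7.22, Rem. 7.23)] -/
theorem hecke_equivariant_of_roof (hN₁ : N₁ ≠ 0) (hP₁ : E₁ * P₁ = P₁) (hQ₁ : Q₁ * E₁ = Q₁)
    (hQP₁ : Q₁ * P₁ = Matrix.scalar (Fin 1) (N₁ : O)) (hPQ₁ : P₁ * Q₁ = Matrix.scalar (Fin m₁) (N₁ : O) * E₁)
    (e₁ : (serreTensor act'' E₁ hE₁).X ≅ B.X) (he₁ : serreTranslate act'' E₁ hE₁ P₁ ≫ e₁.hom = c)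
    (a : O) (b : B.X ⟶ B.X) (hqb : act.i a ≫ q = q ≫ b) (hcb : act''.i a ≫ c = c ≫ b) :
    act.i a ≫ (q ≫ e₁.inv) = (q ≫ e₁.inv) ≫ (serreAction act'' E₁ hE₁).i a := by
  have h1 : (serreAction act'' E₁ hE₁).i a ≫ e₁.hom = e₁.hom ≫ b :=
    serreAction_comp_eq_comp_of_comp_eq act'' E₁ hE₁ P₁ Q₁ c hN₁ hP₁ hQ₁ hQP₁ hPQ₁ e₁.hom he₁ a b hcb
  rw [← Category.assoc, hqb, Category.assoc, Category.assoc, comp_inv_eq_inv_comp_of_comp_hom_eq e₁ h1]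

/-- **(rL) in `ρ′`-form**: `Ker F_q = q̄⁻¹(B̄[𝔠])` ⇒ `Ker F_q = ρ′⁻¹((A″ ⊗ 𝔭⁻¹)[𝔠])` for `ρ′ = q̄ ≫ e₁⁻¹` (`e₁` a homomorphic isomorphism).
[cite: MumfordAV1970, §15 Thm. 1 (p. 143)] [cite: Liu2021, Prop. D.8 (3) (proof, pp. 136–138)] -/
theorem frobenius_kernel_law_of_roof (e₁ : (serreTensor act'' E₁ hE₁).X ≅ B.X) [IsMonHom e₁.hom] {𝔠 : Ideal O}
    (hker : ∀ ⦃T : Over (Spec (.of k))⦄ (t : T ⟶ (AbelianScheme.ofAbelianVariety A).toOver.X),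
      t ≫ relFrobeniusHom p n A = 1 ↔ ∀ a ∈ 𝔠, t ≫ act.i a ≫ q = 1)
    ⦃T : Over (Spec (.of k))⦄ (t : T ⟶ (AbelianScheme.ofAbelianVariety A).toOver.X) :
    t ≫ relFrobeniusHom p n A = 1 ↔ ∀ a ∈ 𝔠, t ≫ act.i a ≫ (q ≫ e₁.inv) = 1 := by
  rw [hker t]
  refine forall₂_congr fun a _ => ?_
  rw [show t ≫ act.i a ≫ q ≫ e₁.inv = ((t ≫ act.i a) ≫ q) ≫ e₁.inv by simp only [Category.assoc], comp_iso_inv_eq_one_iff,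
    Category.assoc]

include hE₂ in
/-- **THE FROBENIUS TWIST READ OFF THE ROOF** (`k = k̄` of exponential characteristic `p`, `q = pⁿ`): a roof `A —q̄→ B̄ ←c̄— A″` of homomorphisms of abelian
`k`-schemes with `q̄` flat surjective, `c̄` surjective with `Ker c̄ = A″[𝔭]` AS SUBGROUP FUNCTORS, a COMMON intertwiner for every `a ∈ 𝒪` ((r4₀)), the
Frobenius-kernel law `Ker F_q = q̄⁻¹(B̄[𝔠])` ((rL)) and presentations of `𝔭⁻¹`, `𝔠⁻¹`, `𝔞⁻¹` with `𝔭𝔠 = 𝔞`.  THEN there are: `e₁ : A″ ⊗_𝒪 𝔭⁻¹ ≅ B̄` with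
`ψ_𝔭 ≫ e₁ = c̄` (a homomorphism, carrying the Serre action to every intertwiner of `c̄`), an `𝒪`-EQUIVARIANT isomorphism of abelian `k`-schemes
**`e′ : A^{(q)} ≅ A″ ⊗_𝒪 𝔞⁻¹`** and the `𝒪`-equivariant cover `χ : A″ ⊗ 𝔭⁻¹ → A″ ⊗ 𝔞⁻¹` with `ψ_𝔭 ≫ χ = ψ_𝔞`, such that **`F_q ≫ e′ = q̄ ≫ e₁⁻¹ ≫ χ`** — «the
Frobenius twist of `A` IS `A″` Serre-twisted by `𝔞⁻¹`, through the roof». [cite: Shimura1998, §13.1 Thm. 1 (pp. 97–99)] [cite: MilneCM2006, §7 (Def. 7.19, Prop. 7.22, Rem. 7.23)]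
[cite: Liu2021, Prop. D.8 (3) (p. 135, proof pp. 136–138)] [cite: MumfordAV1970, §7 Thm. 4 (p. 72)] -/
theorem exists_iso_frobeniusTwist_serreTensor_of_roof [IsAlgClosed k] [IsCommMonObj (serreTensor act'' E₁ hE₁).X]
    [IsMonHom q] [Flat q.left] [Surjective q.left] [QuasiCompact q.left] [IsMonHom c] [Surjective c.left]
    (hN₁ : N₁ ≠ 0) (hP₁ : E₁ * P₁ = P₁) (hQ₁ : Q₁ * E₁ = Q₁)
    (hQP₁ : Q₁ * P₁ = Matrix.scalar (Fin 1) (N₁ : O)) (hPQ₁ : P₁ * Q₁ = Matrix.scalar (Fin m₁) (N₁ : O) * E₁)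
    (hN₂ : N₂ ≠ 0) (hP₂ : E₂ * P₂ = P₂) (hQ₂ : Q₂ * E₂ = Q₂)
    (hQP₂ : Q₂ * P₂ = Matrix.scalar (Fin 1) (N₂ : O)) (hPQ₂ : P₂ * Q₂ = Matrix.scalar (Fin m₂) (N₂ : O) * E₂)
    (hN₃ : N₃ ≠ 0) (hP₃ : E₃ * P₃ = P₃) (hQ₃ : Q₃ * E₃ = Q₃)
    (hQP₃ : Q₃ * P₃ = Matrix.scalar (Fin 1) (N₃ : O)) (hPQ₃ : P₃ * Q₃ = Matrix.scalar (Fin m₃) (N₃ : O) * E₃)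
    {𝔭 𝔠 𝔞 : Ideal O} (h𝔭 : Ideal.span (Set.range fun k => P₁ k 0) = 𝔭) (h𝔠 : Ideal.span (Set.range fun k => P₂ k 0) = 𝔠)
    (h𝔞 : Ideal.span (Set.range fun k => P₃ k 0) = 𝔞) (hmul : 𝔭 * 𝔠 = 𝔞)
    (hcker : ∀ ⦃T : Over (Spec (.of k))⦄ (t : T ⟶ (AbelianScheme.ofAbelianVariety A'').toOver.X), t ≫ c = 1 ↔ ∀ a ∈ 𝔭, t ≫ act''.i a = 1)
    (hequiv : ∀ a : O, ∃ b : B.X ⟶ B.X, act.i a ≫ q = q ≫ b ∧ act''.i a ≫ c = c ≫ b)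
    (hker : ∀ ⦃T : Over (Spec (.of k))⦄ (t : T ⟶ (AbelianScheme.ofAbelianVariety A).toOver.X),
      t ≫ relFrobeniusHom p n A = 1 ↔ ∀ a ∈ 𝔠, t ≫ act.i a ≫ q = 1) :
    ∃ (e₁ : (serreTensor act'' E₁ hE₁).X ≅ B.X)
      (e' : (AbelianScheme.ofAbelianVariety (A.frobeniusTwist p n)).toOver.X ≅ (serreTensor act'' E₃ hE₃).X)
      (χ : (serreTensor act'' E₁ hE₁).X ⟶ (serreTensor act'' E₃ hE₃).X),
      serreTranslate act'' E₁ hE₁ P₁ ≫ e₁.hom = c ∧ IsMonHom e₁.hom ∧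
      (∀ (a : O) (b : B.X ⟶ B.X), act''.i a ≫ c = c ≫ b → (serreAction act'' E₁ hE₁).i a ≫ e₁.hom = e₁.hom ≫ b) ∧
      IsMonHom e'.hom ∧ (∀ a, (act.frobeniusTwist p n).i a ≫ e'.hom = e'.hom ≫ (serreAction act'' E₃ hE₃).i a) ∧
      IsMonHom χ ∧ (∀ a, (serreAction act'' E₁ hE₁).i a ≫ χ = χ ≫ (serreAction act'' E₃ hE₃).i a) ∧
      serreTranslate act'' E₁ hE₁ P₁ ≫ χ = serreTranslate act'' E₃ hE₃ P₃ ∧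
      relFrobeniusHom p n A ≫ e'.hom = q ≫ e₁.inv ≫ χ := by
  -- Step 1: `B̄ ≅ A″ ⊗ 𝔭⁻¹` under `A″`, rank-free from the scheme-theoretic kernel (G1b §3)
  obtain ⟨e₁, he₁, he₁mon, -⟩ := exists_iso_serreTranslate_comp_eq_of_comp_eq_one_iff_forall_mem act'' E₁ hE₁ P₁ Q₁ c
    hN₁ hP₁ hQ₁ hQP₁ hPQ₁ h𝔭 hcker
  have hinter : ∀ (a : O) (b : B.X ⟶ B.X), act''.i a ≫ c = c ≫ b → (serreAction act'' E₁ hE₁).i a ≫ e₁.hom = e₁.hom ≫ b :=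
    fun a b hab => serreAction_comp_eq_comp_of_comp_eq act'' E₁ hE₁ P₁ Q₁ c hN₁ hP₁ hQ₁ hQP₁ hPQ₁ e₁.hom he₁ a b hab
  haveI := he₁mon
  -- Step 2: the Hecke datum `ρ′ := q̄ ≫ e₁⁻¹`, `𝒪`-equivariant fppf, with the Frobenius-kernel law in `ρ′`-form
  haveI : IsMonHom (q ≫ e₁.inv) := inferInstance
  haveI : Flat (q ≫ e₁.inv).left := by rw [Over.comp_left]; infer_instance
  haveI : Surjective (q ≫ e₁.inv).left := by rw [Over.comp_left]; infer_instance
  haveI : QuasiCompact (q ≫ e₁.inv).left := by rw [Over.comp_left]; infer_instance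
  have hρ' : ∀ a, act.i a ≫ (q ≫ e₁.inv) = (q ≫ e₁.inv) ≫ (serreAction act'' E₁ hE₁).i a := fun a => by
    obtain ⟨b, hqb, hcb⟩ := hequiv a
    exact hecke_equivariant_of_roof act act'' E₁ hE₁ P₁ Q₁ q c hN₁ hP₁ hQ₁ hQP₁ hPQ₁ e₁ he₁ a b hqb hcb
  have hker' := frobenius_kernel_law_of_roof p n act act'' E₁ hE₁ q e₁ hker
  -- Step 3: σ2-CORE, π₀-free (`F_q` is a homomorphism: ★ `isMonHom_relFrobeniusHom`)
  haveI := isMonHom_relFrobeniusHom p n A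
  obtain ⟨e', he'mon, he'eq, χ, hχmon, hχeq, hχψ, hF⟩ :=
    exists_iso_relFrobeniusHom_comp_eq_comp_serreTranslate_of_mul_eq p n act (A := A) (B := A'') act''
      E₁ hE₁ P₁ Q₁ E₂ hE₂ P₂ Q₂ E₃ hE₃ P₃ Q₃ (q ≫ e₁.inv) hρ' hN₁ hP₁ hQ₁ hQP₁ hPQ₁ hN₂ hP₂ hQ₂ hQP₂ hPQ₂ hN₃ hP₃ hQ₃ hQP₃ hPQ₃
      h𝔭 h𝔠 h𝔞 hmul hker'
  exact ⟨e₁, e', χ, he₁, he₁mon, hinter, he'mon, he'eq, hχmon, hχeq, hχψ, by rw [hF, Category.assoc]⟩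

end Roof

/-! ## §3 The same in `AbelianSchemeOver (Spec k)` currency (ED. 2): the carriers of the moduli datum (`sch₀Of … x̄ : AbelianSchemeOver (Spec κ̄)`,
`F_q = relFrobeniusOver p n A.X`, twisted action `(act.baseChange (frobSpec k p n)).i a`) — the σ2-CORE's abelian-variety wrappers
`(ofAbelianVariety A.toAffine.toAbelianVariety).toOver = A` are `rfl` (★ `toOver_toAffine`, ★ `ofAbelianVariety_toAbelianVariety`) but opaque to instance
search, so the instances are re-exposed HERE once and the pen passes `Roof₀`'s fields verbatim. -/

section RoofOver

variable {k : Type u} [Field k] (p : ℕ) [ExpChar k p] (n : ℕ) {A A'' B : AbelianSchemeOver (Spec (.of k))} {O : Type*} [CommRing O]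
  (act : A.RingAction O) (act'' : A''.RingAction O) [IsCommMonObj A''.X]
  {m₁ : ℕ} (E₁ : Matrix (Fin m₁) (Fin m₁) O) (hE₁ : E₁ * E₁ = E₁) (P₁ : Matrix (Fin m₁) (Fin 1) O) (Q₁ : Matrix (Fin 1) (Fin m₁) O) {N₁ : ℕ}
  {m₂ : ℕ} (E₂ : Matrix (Fin m₂) (Fin m₂) O) (hE₂ : E₂ * E₂ = E₂) (P₂ : Matrix (Fin m₂) (Fin 1) O) (Q₂ : Matrix (Fin 1) (Fin m₂) O) {N₂ : ℕ}
  {m₃ : ℕ} (E₃ : Matrix (Fin m₃) (Fin m₃) O) (hE₃ : E₃ * E₃ = E₃) (P₃ : Matrix (Fin m₃) (Fin 1) O) (Q₃ : Matrix (Fin 1) (Fin m₃) O) {N₃ : ℕ}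
  (q : A.X ⟶ B.X) (c : A''.X ⟶ B.X)

include hE₂ in
/-- **THE FROBENIUS TWIST READ OFF THE ROOF, `AbelianSchemeOver (Spec k)` currency** (the shape of the moduli datum's `Roof₀`: `q̄ : A.X ⟶ B̄.X` with `A` an abelian
`k`-SCHEME, `F_q = relFrobeniusOver p n A.X : A.X ⟶ (A.baseChange (frobSpec k p n)).X`, twisted action `act.baseChange (frobSpec k p n)`): same hypotheses and
conclusion as `exists_iso_frobeniusTwist_serreTensor_of_roof`. [cite: Shimura1998, §13.1 Thm. 1 (pp. 97–99)] [cite: MilneCM2006, §7 (Def. 7.19, Prop. 7.22, Rem. 7.23)]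
[cite: Liu2021, Prop. D.8 (3) (p. 135, proof pp. 136–138)] [cite: MumfordAV1970, §7 Thm. 4 (p. 72)] -/
theorem exists_iso_frobeniusTwist_serreTensor_of_roof_over [IsAlgClosed k] [IsCommMonObj (serreTensor act'' E₁ hE₁).X]
    [IsMonHom q] [Flat q.left] [Surjective q.left] [QuasiCompact q.left] [IsMonHom c] [Surjective c.left]
    (hN₁ : N₁ ≠ 0) (hP₁ : E₁ * P₁ = P₁) (hQ₁ : Q₁ * E₁ = Q₁)
    (hQP₁ : Q₁ * P₁ = Matrix.scalar (Fin 1) (N₁ : O)) (hPQ₁ : P₁ * Q₁ = Matrix.scalar (Fin m₁) (N₁ : O) * E₁)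
    (hN₂ : N₂ ≠ 0) (hP₂ : E₂ * P₂ = P₂) (hQ₂ : Q₂ * E₂ = Q₂)
    (hQP₂ : Q₂ * P₂ = Matrix.scalar (Fin 1) (N₂ : O)) (hPQ₂ : P₂ * Q₂ = Matrix.scalar (Fin m₂) (N₂ : O) * E₂)
    (hN₃ : N₃ ≠ 0) (hP₃ : E₃ * P₃ = P₃) (hQ₃ : Q₃ * E₃ = Q₃)
    (hQP₃ : Q₃ * P₃ = Matrix.scalar (Fin 1) (N₃ : O)) (hPQ₃ : P₃ * Q₃ = Matrix.scalar (Fin m₃) (N₃ : O) * E₃)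
    {𝔭 𝔠 𝔞 : Ideal O} (h𝔭 : Ideal.span (Set.range fun k => P₁ k 0) = 𝔭) (h𝔠 : Ideal.span (Set.range fun k => P₂ k 0) = 𝔠)
    (h𝔞 : Ideal.span (Set.range fun k => P₃ k 0) = 𝔞) (hmul : 𝔭 * 𝔠 = 𝔞)
    (hcker : ∀ ⦃T : Over (Spec (.of k))⦄ (t : T ⟶ A''.X), t ≫ c = 1 ↔ ∀ a ∈ 𝔭, t ≫ act''.i a = 1)
    (hequiv : ∀ a : O, ∃ b : B.X ⟶ B.X, act.i a ≫ q = q ≫ b ∧ act''.i a ≫ c = c ≫ b)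
    (hker : ∀ ⦃T : Over (Spec (.of k))⦄ (t : T ⟶ A.X),
      t ≫ relFrobeniusOver p n A.X = (1 : T ⟶ (A.baseChange (frobSpec k p n)).X) ↔ ∀ a ∈ 𝔠, t ≫ act.i a ≫ q = 1) :
    ∃ (e₁ : (serreTensor act'' E₁ hE₁).X ≅ B.X)
      (e' : (A.baseChange (frobSpec k p n)).X ≅ (serreTensor act'' E₃ hE₃).X)
      (χ : (serreTensor act'' E₁ hE₁).X ⟶ (serreTensor act'' E₃ hE₃).X),
      serreTranslate act'' E₁ hE₁ P₁ ≫ e₁.hom = c ∧ IsMonHom e₁.hom ∧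
      (∀ (a : O) (b : B.X ⟶ B.X), act''.i a ≫ c = c ≫ b → (serreAction act'' E₁ hE₁).i a ≫ e₁.hom = e₁.hom ≫ b) ∧
      IsMonHom e'.hom ∧ (∀ a, (act.baseChange (frobSpec k p n)).i a ≫ e'.hom = e'.hom ≫ (serreAction act'' E₃ hE₃).i a) ∧
      IsMonHom χ ∧ (∀ a, (serreAction act'' E₁ hE₁).i a ≫ χ = χ ≫ (serreAction act'' E₃ hE₃).i a) ∧
      serreTranslate act'' E₁ hE₁ P₁ ≫ χ = serreTranslate act'' E₃ hE₃ P₃ ∧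
      relFrobeniusOver p n A.X ≫ e'.hom = q ≫ e₁.inv ≫ χ := by
  -- the σ2-CORE carriers `(ofAbelianVariety A.toAffine.toAbelianVariety).toOver` are `rfl`-equal to `A` but opaque to instance search:
  -- pass every instance argument explicitly (each closes by `assumption`/`inferInstance` up to definitional unfolding)
  refine @exists_iso_frobeniusTwist_serreTensor_of_roof k _ p _ n A.toAffine.toAbelianVariety A''.toAffine.toAbelianVariety B O _ act act''
    ‹IsCommMonObj A''.X› m₁ E₁ hE₁ P₁ Q₁ N₁ m₂ E₂ hE₂ P₂ Q₂ N₂ m₃ E₃ hE₃ P₃ Q₃ N₃ q c _ ‹IsCommMonObj (serreTensor act'' E₁ hE₁).X›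
    ‹IsMonHom q› ‹Flat q.left› ‹Surjective q.left› ‹QuasiCompact q.left› ‹IsMonHom c› ‹Surjective c.left›
    hN₁ hP₁ hQ₁ hQP₁ hPQ₁ hN₂ hP₂ hQ₂ hQP₂ hPQ₂ hN₃ hP₃ hQ₃ hQP₃ hPQ₃ 𝔭 𝔠 𝔞 h𝔭 h𝔠 h𝔞 hmul hcker hequiv hker

end RoofOver

end AbelianSchemeOver

end Literature.AlgebraicGeometry.AbelianSchemes

end
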